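import Mathlib
import HarnessLib

/-!
# Route RootDecompLitSlice — cell Uᶜ `CritTameScarIsCritical` (stmt-NavierStokesRegularity-31733):
# ASSEMBLY ALGEBRA of the lagged endpoint one-step at `σ = m(T−t)` — from the raw term bounds of the
# mean-field lever to the two-level lagged bound `hlag` (Mathlib-only; exponent bookkeeping at `μ = 1`)

Helper toward Uᶜ (`--supports 31733`, no item, no node; census instrument decomp-ns-census-1 g58, tree probe
#53c; companion of `RootDecompLitSliceMeanFieldLaggedClosure` (p838279) / `…LaggedEndpoint` (p838329)).

WHAT IT CERTIFIES. Fix two times `s < t < T` with `σ := T − s = m·τ`, `τ := T − t`, `m ≥ 1`, and write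
`D₀ = D(s)`, `D₁ = D(t)` (energy drops), `G = ‖∇ū‖₂` (gradient of the Chebyshev proxy slice `ū = u(s')`,
`s' ∈ (s,T)`), `S = sup_{r∈(t,T)} ‖u(r) − ū‖₂`, `W = ∫_t^T‖∇u‖₂²` (window dissipation), `I₁ = ∫_t^T‖∇u‖₂`,
`I = ∫_t^T‖∇u‖₂^{3/2}`. The decomp-ns writer's one-step (HOME/writer/g43/NOTES-g43.md §MEAN-FIELD LEVER; critic
row 726 (B)) consists of the RAW TERM BOUNDS
* (h0) `D₁ ≤ K√τ + 2T₁ + 2T₃ + 2T₂` — `D₁ = ‖w‖² + 2⟨w,u(T)−ū⟩ + 2⟨w,ū⟩`, `‖w‖² ≤ K√τ` (clock at `t`), tested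
  balance `⟨w,ū⟩ = ∫_t^T[ν⟨∇u,∇ū⟩ + ⟨(u·∇)u,ū⟩]` (blueprint B1/B2 — NOT yet in the tree);
* (h1) `T₁ ≤ K τ^{1/4} σ^{1/4}` (Cauchy–Schwarz + the clock at `t` and at `s'`);
* (h3) `T₃ ≤ ν G I₁` (frame Cauchy–Schwarz, `MeanFieldTrilinear.abs_integral_sum_inner_fderiv_le`, p838030);
* (h2) `T₂ ≤ C (G √S I + G √G √S I₁)` (antisymmetry + Hölder 6·2·3 + Sobolev + `L³`-interpolation:
  `MeanFieldTrilinear.abs_integral_inner_convect_le`, `MeanFieldSliceCurrency.*`; `C = C_S^{3/2}`),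
and the CURRENCY CONVERSIONS
* (c1) `G² ≤ D₀/(νσ)` (Chebyshev slice `MeanFieldTimeSide.exists_slice_dissipation_le`, p838100 — PROXY level only);
* (c2) `S ≤ 2√K σ^{1/4}` (the clock at `r` and at `s'`);
* (c3) `W ≤ D₁/(2ν)` (`MeanFieldTimeSide.windowDissipation_le` — WINDOW level only);
* (c4) `I₁ ≤ √τ √W`, (c5) `I ≤ τ^{1/4} W^{3/4}` (time power means, `MeanFieldTimeSide.windowDissipation_rpow_le`).
`laggedBound_of_termBounds`: (h0)–(c5) ⟹ the two-level lagged bound of `MeanFieldLaggedEndpoint` (`hlag`)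
VERBATIM, `D₁/√τ ≤ A(1+m^{1/4}) + (B/m^{1/4})φ₀^{1/2}φ₁^{1/2} + (c/m^{1/8})φ₀^{1/2}φ₁^{3/4} + (c/m^{1/4})φ₀^{3/4}φ₁^{1/2}`,
`φ₀ = D₀/√σ`, `φ₁ = D₁/√τ`, with the EXPLICIT constants `A = 2K`, `B = √2`, `c = 4 C K^{1/4} ν^{−5/4}` (the
writer's `c K^{1/4} ν^{−5/4}`). Fourth roots are written as double square roots (`τ^{1/4} = √√τ`,
`W^{3/4} = √W·√√W`, `G^{3/2} = G√G`). Proof: eighth roots `a⁸ = τ`, `b⁸ = m`, fourth roots `p⁴ = φ₀`,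
`q⁴ = φ₁`, `r⁴ = ν`, `d⁴ = 2`, `κ⁴ = K` turn every bound into a monomial bound; after division by `a⁴ = √τ` the
sum reads `q⁴ ≤ K(1+2b²) + (d²/b²)p²q² + (2Cκ/r⁵)((1/d)·p²q³/b + p³q²/b²)`.

So, modulo the tested balance (h0, blueprint B1/B2) and the named slice facts, the antecedent of
`MeanFieldLaggedEndpoint.energyHalfHolder_of_laggedEndpointBound` is BOOKKEEPING: the endpoint of Uᶜ needs no
input beyond the writer's one-step ingredients. All statements def-free, standard axioms; pure real algebra
(no Navier–Stokes object); the small product/root tools are local to the proof. Rung 0: nothing here proves NS regularity. [folklore]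
-/

set_option linter.dupNamespace false

namespace Summit.NavierStokesRegularity.NavierStokesRegularity.Theorems

namespace MeanFieldLaggedAssembly

/-! ## §1 Small tools -/

/-- The triple square root is an eighth root: `(√√√x)⁸ = x` for `x ≥ 0`. [folklore] -/
theorem sqrt3_pow8 {x : ℝ} (hx : 0 ≤ x) : (Real.sqrt (Real.sqrt (Real.sqrt x))) ^ 8 = x := by
  rw [show (Real.sqrt (Real.sqrt (Real.sqrt x))) ^ 8 = (((Real.sqrt (Real.sqrt (Real.sqrt x))) ^ 2) ^ 2) ^ 2
    by ring, Real.sq_sqrt (Real.sqrt_nonneg _), Real.sq_sqrt (Real.sqrt_nonneg _), Real.sq_sqrt hx]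

/-- The double square root is a fourth root: `(√√x)⁴ = x` for `x ≥ 0`. [folklore] -/
theorem sqrt2_pow4 {x : ℝ} (hx : 0 ≤ x) : (Real.sqrt (Real.sqrt x)) ^ 4 = x := by
  rw [show (Real.sqrt (Real.sqrt x)) ^ 4 = ((Real.sqrt (Real.sqrt x)) ^ 2) ^ 2 by ring,
    Real.sq_sqrt (Real.sqrt_nonneg _), Real.sq_sqrt hx]

/-- `√(z²ᵏ) = zᵏ` for `z ≥ 0`. [folklore] -/
theorem sqrt_pow_even {z : ℝ} (hz : 0 ≤ z) (k : ℕ) : Real.sqrt (z ^ (2 * k)) = z ^ k := by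
  rw [pow_mul', Real.sqrt_sq (pow_nonneg hz k)]

/-! ## §2 The assembly -/

/-- ★ **Assembly of the lagged endpoint bound from the raw one-step term bounds** (`σ = m τ`, `μ = 1`).
With the dictionary of the module docstring: the raw bounds (h0) `D₁ ≤ K√τ + 2T₁ + 2T₃ + 2T₂`,
(h1) `T₁ ≤ K·√√τ·√√σ`, (h3) `T₃ ≤ ν G I₁`, (h2) `T₂ ≤ C(G√S·I + G√G√S·I₁)` and the conversions
(c1) `G² ≤ D₀/(νσ)`, (c2) `S ≤ 2√K·√√σ`, (c3) `W ≤ D₁/(2ν)`, (c4) `I₁ ≤ √τ√W`, (c5) `I ≤ √√τ·(√W·√√W)` give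
`D₁/√τ ≤ 2K(1+m^{1/4}) + (√2/m^{1/4})φ₀^{1/2}φ₁^{1/2} + (c/m^{1/8})φ₀^{1/2}φ₁^{3/4} + (c/m^{1/4})φ₀^{3/4}φ₁^{1/2}`
with `φ₀ = D₀/√σ`, `φ₁ = D₁/√τ`, `c = 4CK^{1/4}/ν^{5/4}` — the antecedent `hlag` of
`MeanFieldLaggedEndpoint.energyHalfHolder_of_laggedEndpointBound` at the pair `(s,t)`, verbatim. (Eighth roots
`a⁸ = τ`, `b⁸ = m` and fourth roots `p⁴ = φ₀`, `q⁴ = φ₁`, `r⁴ = ν`, `d⁴ = 2`, `κ⁴ = K` make every bound a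
monomial bound; divide by `a⁴ = √τ`.) [folklore] -/
theorem laggedBound_of_termBounds {K ν C m τ σ D₀ D₁ G S W I₁ I T₁ T₂ T₃ : ℝ}
    (hK : 0 ≤ K) (hν : 0 < ν) (hC : 0 ≤ C) (hm : 1 ≤ m) (hτ : 0 < τ) (hσ : σ = m * τ)
    (hD₀ : 0 ≤ D₀) (hD₁ : 0 ≤ D₁) (hG : 0 ≤ G) (hI₁ : 0 ≤ I₁) (hI : 0 ≤ I)
    (h0 : D₁ ≤ K * Real.sqrt τ + 2 * T₁ + 2 * T₃ + 2 * T₂)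
    (h1 : T₁ ≤ K * Real.sqrt (Real.sqrt τ) * Real.sqrt (Real.sqrt σ))
    (h3 : T₃ ≤ ν * G * I₁)
    (h2 : T₂ ≤ C * (G * Real.sqrt S * I + G * Real.sqrt G * Real.sqrt S * I₁))
    (c1 : G ^ 2 ≤ D₀ / (ν * σ)) (c2 : S ≤ 2 * Real.sqrt K * Real.sqrt (Real.sqrt σ))
    (c3 : W ≤ D₁ / (2 * ν)) (c4 : I₁ ≤ Real.sqrt τ * Real.sqrt W)
    (c5 : I ≤ Real.sqrt (Real.sqrt τ) * (Real.sqrt W * Real.sqrt (Real.sqrt W))) :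
    D₁ / Real.sqrt τ ≤ 2 * K * (1 + m ^ (1 / 4 : ℝ))
      + Real.sqrt 2 / m ^ (1 / 4 : ℝ) *
        ((D₀ / Real.sqrt σ) ^ (1 / 2 : ℝ) * (D₁ / Real.sqrt τ) ^ (1 / 2 : ℝ))
      + (4 * C * K ^ (1 / 4 : ℝ) / ν ^ (5 / 4 : ℝ)) / m ^ (1 / 8 : ℝ) *
        ((D₀ / Real.sqrt σ) ^ (1 / 2 : ℝ) * (D₁ / Real.sqrt τ) ^ (3 / 4 : ℝ))
      + (4 * C * K ^ (1 / 4 : ℝ) / ν ^ (5 / 4 : ℝ)) / m ^ (1 / 4 : ℝ) *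
        ((D₀ / Real.sqrt σ) ^ (3 / 4 : ℝ) * (D₁ / Real.sqrt τ) ^ (1 / 2 : ℝ)) := by
  have hm0 : 0 < m := by linarith
  have hσ0 : 0 < σ := by rw [hσ]; positivity
  -- local tools: products of bounds between non-negative reals; real powers of fourth/eighth powers
  have mul3_le : ∀ {x₁ x₂ x₃ y₁ y₂ y₃ : ℝ}, x₁ ≤ y₁ → x₂ ≤ y₂ → x₃ ≤ y₃ → 0 ≤ x₁ → 0 ≤ x₂ → 0 ≤ x₃ →
      x₁ * x₂ * x₃ ≤ y₁ * y₂ * y₃ := fun h₁ h₂ h₃ hx₁ hx₂ hx₃ =>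
    mul_le_mul (mul_le_mul h₁ h₂ hx₂ (hx₁.trans h₁)) h₃ hx₃ (mul_nonneg (hx₁.trans h₁) (hx₂.trans h₂))
  have mul4_le : ∀ {x₁ x₂ x₃ x₄ y₁ y₂ y₃ y₄ : ℝ}, x₁ ≤ y₁ → x₂ ≤ y₂ → x₃ ≤ y₃ → x₄ ≤ y₄ →
      0 ≤ x₁ → 0 ≤ x₂ → 0 ≤ x₃ → 0 ≤ x₄ → x₁ * x₂ * x₃ * x₄ ≤ y₁ * y₂ * y₃ * y₄ :=
    fun h₁ h₂ h₃ h₄ hx₁ hx₂ hx₃ hx₄ =>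
    mul_le_mul (mul3_le h₁ h₂ h₃ hx₁ hx₂ hx₃) h₄ hx₄
      (mul_nonneg (mul_nonneg (hx₁.trans h₁) (hx₂.trans h₂)) (hx₃.trans h₃))
  have pow_rpow : ∀ {z : ℝ} (n k : ℕ) (e : ℝ), 0 ≤ z → (n : ℝ) * e = k → (z ^ n) ^ e = z ^ k := by
    intro z n k e hz he
    rw [← Real.rpow_natCast_mul hz, he, Real.rpow_natCast]
  -- the atoms
  obtain ⟨a, ha⟩ : ∃ a : ℝ, a = Real.sqrt (Real.sqrt (Real.sqrt τ)) := ⟨_, rfl⟩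
  have ha0 : 0 < a := by rw [ha]; positivity
  have ha8 : a ^ 8 = τ := by rw [ha]; exact sqrt3_pow8 hτ.le
  obtain ⟨b, hb⟩ : ∃ b : ℝ, b = Real.sqrt (Real.sqrt (Real.sqrt m)) := ⟨_, rfl⟩
  have hb1 : 1 ≤ b := by
    rw [hb]; exact Real.one_le_sqrt.2 (Real.one_le_sqrt.2 (Real.one_le_sqrt.2 hm))
  have hb0 : 0 < b := by linarith
  have hb8 : b ^ 8 = m := by rw [hb]; exact sqrt3_pow8 hm0.le
  obtain ⟨r, hr⟩ : ∃ r : ℝ, r = Real.sqrt (Real.sqrt ν) := ⟨_, rfl⟩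
  have hr0 : 0 < r := by rw [hr]; positivity
  have hr4 : r ^ 4 = ν := by rw [hr]; exact sqrt2_pow4 hν.le
  obtain ⟨d, hd⟩ : ∃ d : ℝ, d = Real.sqrt (Real.sqrt 2) := ⟨_, rfl⟩
  have hd1 : 1 ≤ d := by
    rw [hd]; exact Real.one_le_sqrt.2 (Real.one_le_sqrt.2 (by norm_num))
  have hd0 : 0 < d := by linarith
  have hd4 : d ^ 4 = 2 := by rw [hd]; exact sqrt2_pow4 (by norm_num)
  obtain ⟨κ, hκ⟩ : ∃ κ : ℝ, κ = Real.sqrt (Real.sqrt K) := ⟨_, rfl⟩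
  have hκ0 : 0 ≤ κ := by rw [hκ]; positivity
  have hκ4 : κ ^ 4 = K := by rw [hκ]; exact sqrt2_pow4 hK
  obtain ⟨p, hp⟩ : ∃ p : ℝ, p = Real.sqrt (Real.sqrt (D₀ / Real.sqrt σ)) := ⟨_, rfl⟩
  have hp0 : 0 ≤ p := by rw [hp]; positivity
  have hp4 : p ^ 4 = D₀ / Real.sqrt σ := by
    rw [hp]; exact sqrt2_pow4 (div_nonneg hD₀ (Real.sqrt_nonneg _))
  obtain ⟨q, hq⟩ : ∃ q : ℝ, q = Real.sqrt (Real.sqrt (D₁ / Real.sqrt τ)) := ⟨_, rfl⟩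
  have hq0 : 0 ≤ q := by rw [hq]; positivity
  have hq4 : q ^ 4 = D₁ / Real.sqrt τ := by
    rw [hq]; exact sqrt2_pow4 (div_nonneg hD₁ (Real.sqrt_nonneg _))
  -- radicals in atoms
  have hab0 : 0 < a * b := mul_pos ha0 hb0
  have eτ2 : Real.sqrt τ = a ^ 4 := by rw [← ha8]; exact sqrt_pow_even ha0.le 4
  have eτ4 : Real.sqrt (Real.sqrt τ) = a ^ 2 := by rw [eτ2]; exact sqrt_pow_even ha0.le 2
  have eσ : σ = (a * b) ^ 8 := by rw [hσ, ← ha8, ← hb8]; ring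
  have eσ2 : Real.sqrt σ = (a * b) ^ 4 := by rw [eσ]; exact sqrt_pow_even hab0.le 4
  have eσ4 : Real.sqrt (Real.sqrt σ) = (a * b) ^ 2 := by rw [eσ2]; exact sqrt_pow_even hab0.le 2
  have eK2 : Real.sqrt K = κ ^ 2 := by rw [← hκ4]; exact sqrt_pow_even hκ0 2
  have e22 : Real.sqrt 2 = d ^ 2 := by rw [← hd4]; exact sqrt_pow_even hd0.le 2
  have eν : ν = r ^ 4 := hr4.symm
  have ha4 : 0 < a ^ 4 := pow_pos ha0 4
  have eD₀ : D₀ = p ^ 4 * (a * b) ^ 4 := by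
    have : D₀ / Real.sqrt σ * Real.sqrt σ = D₀ := div_mul_cancel₀ _ (by rw [eσ2]; positivity)
    rw [← this, ← hp4, eσ2]
  have eD₁ : D₁ = q ^ 4 * a ^ 4 := by
    have : D₁ / Real.sqrt τ * Real.sqrt τ = D₁ := div_mul_cancel₀ _ (by rw [eτ2]; positivity)
    rw [← this, ← hq4, eτ2]
  -- derived bounds for the proxy gradient, the window dissipation and the fluctuation
  have hGb : G ≤ p ^ 2 / (r ^ 2 * (a * b) ^ 2) := by
    have e : D₀ / (ν * σ) = (p ^ 2 / (r ^ 2 * (a * b) ^ 2)) ^ 2 := by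
      rw [eD₀, eν, eσ]; field_simp
    have hsq : G ^ 2 ≤ (p ^ 2 / (r ^ 2 * (a * b) ^ 2)) ^ 2 := by rw [← e]; exact c1
    exact (pow_le_pow_iff_left₀ hG (by positivity) two_ne_zero).1 hsq
  have hsqG : Real.sqrt G ≤ p / (r * (a * b)) := by
    have e : p ^ 2 / (r ^ 2 * (a * b) ^ 2) = (p / (r * (a * b))) ^ 2 := by ring
    calc Real.sqrt G ≤ Real.sqrt ((p / (r * (a * b))) ^ 2) := Real.sqrt_le_sqrt (by rw [← e]; exact hGb)
      _ = p / (r * (a * b)) := Real.sqrt_sq (by positivity)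
  have hWb : W ≤ ((q * a / (d * r)) ^ 2) ^ 2 := by
    have e : D₁ / (2 * ν) = ((q * a / (d * r)) ^ 2) ^ 2 := by
      rw [eD₁, eν, ← hd4]; field_simp
    rw [← e]; exact c3
  have hsqW : Real.sqrt W ≤ (q * a / (d * r)) ^ 2 := by
    calc Real.sqrt W ≤ Real.sqrt (((q * a / (d * r)) ^ 2) ^ 2) := Real.sqrt_le_sqrt hWb
      _ = (q * a / (d * r)) ^ 2 := Real.sqrt_sq (by positivity)
  have hsq2W : Real.sqrt (Real.sqrt W) ≤ q * a / (d * r) := by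
    calc Real.sqrt (Real.sqrt W) ≤ Real.sqrt ((q * a / (d * r)) ^ 2) := Real.sqrt_le_sqrt hsqW
      _ = q * a / (d * r) := Real.sqrt_sq (by positivity)
  have hSb : S ≤ (d ^ 2 * κ * (a * b)) ^ 2 := by
    have e : 2 * Real.sqrt K * Real.sqrt (Real.sqrt σ) = (d ^ 2 * κ * (a * b)) ^ 2 := by
      rw [eK2, eσ4, ← hd4]; ring
    rw [← e]; exact c2
  have hsqS : Real.sqrt S ≤ d ^ 2 * κ * (a * b) := by
    calc Real.sqrt S ≤ Real.sqrt ((d ^ 2 * κ * (a * b)) ^ 2) := Real.sqrt_le_sqrt hSb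
      _ = d ^ 2 * κ * (a * b) := Real.sqrt_sq (by positivity)
  have hI₁b : I₁ ≤ a ^ 4 * (q * a / (d * r)) ^ 2 := by
    calc I₁ ≤ Real.sqrt τ * Real.sqrt W := c4
      _ ≤ a ^ 4 * (q * a / (d * r)) ^ 2 := by
        rw [eτ2]; exact mul_le_mul_of_nonneg_left hsqW ha4.le
  have hIb : I ≤ a ^ 2 * ((q * a / (d * r)) ^ 2 * (q * a / (d * r))) := by
    calc I ≤ Real.sqrt (Real.sqrt τ) * (Real.sqrt W * Real.sqrt (Real.sqrt W)) := c5
      _ ≤ a ^ 2 * ((q * a / (d * r)) ^ 2 * (q * a / (d * r))) := by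
        rw [eτ4]
        exact mul_le_mul_of_nonneg_left
          (mul_le_mul hsqW hsq2W (Real.sqrt_nonneg _) (by positivity)) (pow_nonneg ha0.le 2)
  -- the four terms as monomials
  have hqadr : 0 ≤ q * a / (d * r) := by positivity
  have hT₁ : T₁ ≤ K * a ^ 4 * b ^ 2 := by
    calc T₁ ≤ K * Real.sqrt (Real.sqrt τ) * Real.sqrt (Real.sqrt σ) := h1
      _ = K * a ^ 4 * b ^ 2 := by rw [eτ4, eσ4]; ring
  have hT₃ : T₃ ≤ p ^ 2 * q ^ 2 * a ^ 4 / (d ^ 2 * b ^ 2) := by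
    calc T₃ ≤ ν * G * I₁ := h3
      _ ≤ ν * (p ^ 2 / (r ^ 2 * (a * b) ^ 2)) * (a ^ 4 * (q * a / (d * r)) ^ 2) :=
        mul3_le le_rfl hGb hI₁b hν.le hG hI₁
      _ = p ^ 2 * q ^ 2 * a ^ 4 / (d ^ 2 * b ^ 2) := by rw [eν]; field_simp
  have hT₂a : G * Real.sqrt S * I ≤ κ / (d * r ^ 5) * (p ^ 2 * q ^ 3 * a ^ 4 / b) := by
    calc G * Real.sqrt S * I
        ≤ (p ^ 2 / (r ^ 2 * (a * b) ^ 2)) * (d ^ 2 * κ * (a * b)) *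
          (a ^ 2 * ((q * a / (d * r)) ^ 2 * (q * a / (d * r)))) :=
        mul3_le hGb hsqS hIb hG (Real.sqrt_nonneg _) hI
      _ = κ / (d * r ^ 5) * (p ^ 2 * q ^ 3 * a ^ 4 / b) := by field_simp
  have hT₂b : G * Real.sqrt G * Real.sqrt S * I₁ ≤ κ / r ^ 5 * (p ^ 3 * q ^ 2 * a ^ 4 / b ^ 2) := by
    calc G * Real.sqrt G * Real.sqrt S * I₁
        ≤ (p ^ 2 / (r ^ 2 * (a * b) ^ 2)) * (p / (r * (a * b))) * (d ^ 2 * κ * (a * b)) *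
          (a ^ 4 * (q * a / (d * r)) ^ 2) :=
        mul4_le hGb hsqG hsqS hI₁b hG (Real.sqrt_nonneg _) (Real.sqrt_nonneg _) hI₁
      _ = κ / r ^ 5 * (p ^ 3 * q ^ 2 * a ^ 4 / b ^ 2) := by field_simp
  have hT₂a' : G * Real.sqrt S * I ≤ κ / r ^ 5 * (p ^ 2 * q ^ 3 * a ^ 4 / b) := by
    refine hT₂a.trans (mul_le_mul_of_nonneg_right ?_ (by positivity))
    exact div_le_div_of_nonneg_left hκ0 (by positivity)
      (le_mul_of_one_le_left (by positivity) hd1)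
  have hT₂ : T₂ ≤ C * (κ / r ^ 5) * (p ^ 2 * q ^ 3 * a ^ 4 / b + p ^ 3 * q ^ 2 * a ^ 4 / b ^ 2) := by
    calc T₂ ≤ C * (G * Real.sqrt S * I + G * Real.sqrt G * Real.sqrt S * I₁) := h2
      _ ≤ C * (κ / r ^ 5 * (p ^ 2 * q ^ 3 * a ^ 4 / b) + κ / r ^ 5 * (p ^ 3 * q ^ 2 * a ^ 4 / b ^ 2)) :=
        mul_le_mul_of_nonneg_left (add_le_add hT₂a' hT₂b) hC
      _ = C * (κ / r ^ 5) * (p ^ 2 * q ^ 3 * a ^ 4 / b + p ^ 3 * q ^ 2 * a ^ 4 / b ^ 2) := by ring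
  -- the sum, divided by `a⁴ = √τ`
  have hsum : q ^ 4 ≤ K * (1 + 2 * b ^ 2) + 2 / d ^ 2 * (p ^ 2 * q ^ 2) / b ^ 2
      + 2 * C * (κ / r ^ 5) * (p ^ 2 * q ^ 3 / b + p ^ 3 * q ^ 2 / b ^ 2) := by
    have h := h0
    rw [eD₁, eτ2] at h
    have h' : q ^ 4 * a ^ 4 ≤ (K * (1 + 2 * b ^ 2) + 2 / d ^ 2 * (p ^ 2 * q ^ 2) / b ^ 2
        + 2 * C * (κ / r ^ 5) * (p ^ 2 * q ^ 3 / b + p ^ 3 * q ^ 2 / b ^ 2)) * a ^ 4 := by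
      have e : (K * (1 + 2 * b ^ 2) + 2 / d ^ 2 * (p ^ 2 * q ^ 2) / b ^ 2
          + 2 * C * (κ / r ^ 5) * (p ^ 2 * q ^ 3 / b + p ^ 3 * q ^ 2 / b ^ 2)) * a ^ 4
          = K * a ^ 4 + 2 * (K * a ^ 4 * b ^ 2) + 2 * (p ^ 2 * q ^ 2 * a ^ 4 / (d ^ 2 * b ^ 2))
          + 2 * (C * (κ / r ^ 5) * (p ^ 2 * q ^ 3 * a ^ 4 / b + p ^ 3 * q ^ 2 * a ^ 4 / b ^ 2)) := by
        field_simp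
      rw [e]; linarith
    exact le_of_mul_le_mul_right h' ha4
  -- back to the stated currencies
  have eφ₀h : (D₀ / Real.sqrt σ) ^ (1 / 2 : ℝ) = p ^ 2 := by
    rw [← hp4]; exact pow_rpow 4 2 _ hp0 (by norm_num)
  have eφ₀t : (D₀ / Real.sqrt σ) ^ (3 / 4 : ℝ) = p ^ 3 := by
    rw [← hp4]; exact pow_rpow 4 3 _ hp0 (by norm_num)
  have eφ₁h : (D₁ / Real.sqrt τ) ^ (1 / 2 : ℝ) = q ^ 2 := by
    rw [← hq4]; exact pow_rpow 4 2 _ hq0 (by norm_num)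
  have eφ₁t : (D₁ / Real.sqrt τ) ^ (3 / 4 : ℝ) = q ^ 3 := by
    rw [← hq4]; exact pow_rpow 4 3 _ hq0 (by norm_num)
  have em4 : m ^ (1 / 4 : ℝ) = b ^ 2 := by rw [← hb8]; exact pow_rpow 8 2 _ hb0.le (by norm_num)
  have em8 : m ^ (1 / 8 : ℝ) = b := by
    rw [← hb8]
    have := pow_rpow 8 1 (1 / 8 : ℝ) hb0.le (by norm_num)
    rwa [pow_one] at this
  have eK4 : K ^ (1 / 4 : ℝ) = κ := by
    rw [← hκ4]
    have := pow_rpow 4 1 (1 / 4 : ℝ) hκ0 (by norm_num)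
    rwa [pow_one] at this
  have eν5 : ν ^ (5 / 4 : ℝ) = r ^ 5 := by rw [eν]; exact pow_rpow 4 5 _ hr0.le (by norm_num)
  rw [eφ₀h, eφ₀t, eφ₁h, eφ₁t, ← hq4, em4, em8, eK4, eν5, e22]
  -- compare term by term
  have hd22 : d ^ 2 * d ^ 2 = 2 := by rw [← hd4]; ring
  have hd2 : 2 / d ^ 2 = d ^ 2 := by
    rw [div_eq_iff (pow_ne_zero 2 hd0.ne')]; exact hd22.symm
  rw [hd2] at hsum
  have hb2 : 1 ≤ b ^ 2 := one_le_pow₀ hb1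
  have t1 : K * (1 + 2 * b ^ 2) ≤ 2 * K * (1 + b ^ 2) := by linarith
  have t2 : d ^ 2 * (p ^ 2 * q ^ 2) / b ^ 2 = d ^ 2 / b ^ 2 * (p ^ 2 * q ^ 2) := by ring
  have hpq3 : 0 ≤ p ^ 2 * q ^ 3 / b := by positivity
  have hp3q : 0 ≤ p ^ 3 * q ^ 2 / b ^ 2 := by positivity
  have hCκ : 0 ≤ C * (κ / r ^ 5) := by positivity
  have t3 : 2 * C * (κ / r ^ 5) * (p ^ 2 * q ^ 3 / b + p ^ 3 * q ^ 2 / b ^ 2)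
      ≤ 4 * C * κ / r ^ 5 / b * (p ^ 2 * q ^ 3) + 4 * C * κ / r ^ 5 / b ^ 2 * (p ^ 3 * q ^ 2) := by
    have e : 4 * C * κ / r ^ 5 / b * (p ^ 2 * q ^ 3) + 4 * C * κ / r ^ 5 / b ^ 2 * (p ^ 3 * q ^ 2)
        = 4 * C * (κ / r ^ 5) * (p ^ 2 * q ^ 3 / b + p ^ 3 * q ^ 2 / b ^ 2) := by ring
    rw [e]; linarith [mul_nonneg hCκ (add_nonneg hpq3 hp3q)]
  linarith [hsum, t1, t2, t3]

end MeanFieldLaggedAssembly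

end Summit.NavierStokesRegularity.NavierStokesRegularity.Theorems
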